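import Literature.NumberTheory.GaloisRepresentations.LocalUnramifiedLevelMaxUnramified
import Literature.NumberTheory.GaloisRepresentations.LocalUnitsUnramifiedFrame
import Literature.AnabelianGeometry.AbsoluteAnabelian.LocalUnramifiedCriterion
import HarnessLib

/-!
# Uniqueness and monotonicity of the unramified levels `F_n = F(ζ_{q^n−1})`: every finite `E ⊆ F^{nr}` IS `F_{[E:F]}`,
# `n ∣ n' ⇒ F_n ≤ F_{n'}`, and the chain `(F_{d·p^k})_k` is a ready-made unramified tower of degrees `d·p^k`

Serre, *Local Fields* (1979), Ch. III §5 Thm. 3 and Ch. IV §4; Neukirch, *Algebraic Number Theory* (1999), Ch. II (7.12)–(7.13):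
a local field has exactly ONE unramified extension of each degree `n` inside `F̄`, namely `F_n = F(μ_{q^n−1})`, and `F_n ⊆ F_{n'}` iff
`n ∣ n'`.  The tree has the levels `LocalWeilDatum.unramifiedLevel F n` with `[F_n : F] = n`, `F_n/F` Galois, `F_n ≤ maxUnramified F`, and
the Weil-group description `W_F ∩ G_{F_n} = deg⁻¹(nℤ)` (`fieldSubgroup_unramifiedLevel`); and, for any finite `E` with `I_F ≤ G_E`,
`W_F ∩ G_E = deg⁻¹([E:F]ℤ)` (`fieldSubgroup_iff_dvd_of_absInertia_le`) plus the Galois correspondence through the Weil group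
(`mem_iff_forall_fieldSubgroup_smul`).  This file draws the conclusions (characteristic `0`):

* `absInertia_le_galFixing_of_le_maxUnramified` — `E ≤ F^{nr} ⇒ I_F ≤ G_E`; `mem_fieldSubgroup_iff_dvd_deg_of_le_maxUnramified` —
  `W_F ∩ G_E = deg⁻¹([E:F]ℤ)` for finite `E ≤ F^{nr}`;
* ★★ `eq_unramifiedLevel_of_le_maxUnramified` — **a finite `E ≤ F^{nr}` equals `F_{[E:F]}`** (UNIQUENESS of the unramified extension
  of each degree); `eq_unramifiedLevel_of_finrank_eq`;
* ★ `unramifiedLevel_le_of_dvd` — **`n ∣ n' ⇒ F_n ≤ F_{n'}`**; `le_unramifiedLevel_of_finrank_dvd` — a finite `E ≤ F^{nr}` with `[E:F] ∣ n`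
  lies in `F_n`;
* ★ `monotone_unramifiedLevel_mul_pow`, `finrank_unramifiedLevel_mul_pow`, `isGalois_unramifiedLevel_mul_pow`,
  `unramifiedLevel_mul_pow_le_maxUnramified`, `eq_unramifiedLevel_mul_pow_of_finrank_eq` — **the chain `E_k := F_{d·p^k}` is a monotone
  tower of finite Galois subextensions of `F^{nr}` with `[E_k : F] = d·p^k`, and every finite `E ≤ F^{nr}` of degree `d·p^e` is `E_e`** —
  exactly the hypotheses `hmono`/`hE`/`hdeg` of the Coleman two-variable files (`LubinTateUnramifiedTowerIwasawaCyclic`,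
  `LubinTateColemanTwoVariableTransformCyclicTwo`, …), so the unramified layers of de Shalit's two-variable towers (completions of
  `K(𝔤𝔭̄^{m+1})` at `𝔓 ∣ 𝔭`, unramified of degrees `d·p^{e_m}`) are the `E_{e_m}` and their units transfer by `LubinTateTowerCofinal`.

Everything PROVED (0 sorry, no named facts, no new definitions).

## References

* J.-P. Serre, *Local Fields* (1979), Ch. III §5 Thm. 3; Ch. IV §4 Prop. 16 and Cor. 2. [SerreLocalFields1979]
* J. Neukirch, *Algebraic Number Theory* (1999), Ch. II (7.12)–(7.13); Ch. IV §4. [NeukirchANT1999]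
* E. de Shalit, *Iwasawa theory of elliptic curves with complex multiplication* (1987), Ch. I §1.1, Ch. III §1.3. [deShalit1987]
-/

noncomputable section

namespace Literature.NumberTheory.GaloisRepresentations

namespace IsNonarchimedeanLocalField

open Field ValuativeRel LocalWeilDatum Literature.AnabelianGeometry.AbsoluteAnabelian

variable {F : Type} [Field F] [ValuativeRel F] [TopologicalSpace F] [IsNonarchimedeanLocalField F]

/-! ### `E ≤ F^{nr}` ⇒ `I_F ≤ G_E` and `W_F ∩ G_E = deg⁻¹([E:F]ℤ)` -/

/-- **The inertia group fixes every subextension of `F^{nr}`**: `E ≤ maxUnramified F ⇒ I_F ≤ G_E`.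
[cite: SerreLocalFields1979, Ch. IV §4 Cor. 2 to Prop. 16] -/
theorem absInertia_le_galFixing_of_le_maxUnramified {E : IntermediateField F (AlgebraicClosure F)} (hE : E ≤ maxUnramified F) :
    absInertia F ≤ galFixing F E := fun _ hσ =>
  (mem_galFixing_iff F).mpr fun x hx => (mem_absInertia_iff_forall_mem_maxUnramified (F := F)).mp hσ x (hE hx)

/-- **`W_F ∩ G_E = deg⁻¹([E:F]ℤ)` for a finite `E ≤ F^{nr}`**: a Weil element fixes `E` iff its degree is a multiple of `[E:F]`.
[cite: NeukirchANT1999, Ch. IV §4] [cite: SerreLocalFields1979, Ch. IV §4 Cor. to Prop. 16] -/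
theorem mem_fieldSubgroup_iff_dvd_deg_of_le_maxUnramified [CharZero F] {E : IntermediateField F (AlgebraicClosure F)} [FiniteDimensional F E]
    (hE : E ≤ maxUnramified F) (w : WeilGroup F) :
    w ∈ fieldSubgroup F E ↔ ((Module.finrank F E : ℕ) : ℤ) ∣ WeilGroup.deg w :=
  fieldSubgroup_iff_dvd_of_absInertia_le E (absInertia_le_galFixing_of_le_maxUnramified hE) w

/-! ### Uniqueness of the unramified extension of each degree -/

/-- ★★ **A finite `E ≤ F^{nr}` IS the unramified level of its degree: `E = F_{[E:F]} = F(ζ_{q^{[E:F]}−1})`** (both have Weil subgroup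
`deg⁻¹([E:F]ℤ)`, and a finite subextension of `F̄` is recovered from its Weil subgroup, `mem_iff_forall_fieldSubgroup_smul`).
[cite: SerreLocalFields1979, Ch. III §5 Thm. 3] [cite: NeukirchANT1999, Ch. II (7.13)] -/
theorem eq_unramifiedLevel_of_le_maxUnramified [CharZero F] {E : IntermediateField F (AlgebraicClosure F)} [FiniteDimensional F E]
    (hE : E ≤ maxUnramified F) : E = unramifiedLevel F (Module.finrank F E) := by
  have hn : 0 < Module.finrank F E := Module.finrank_pos
  haveI : FiniteDimensional F (unramifiedLevel F (Module.finrank F E)) := (unramifiedLevel_finite_abelian_unramified F hn).1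
  refine le_antisymm (fun x hx => ?_) (fun x hx => ?_)
  · rw [mem_iff_forall_fieldSubgroup_smul (unramifiedLevel F (Module.finrank F E))]
    intro w hw
    rw [fieldSubgroup_unramifiedLevel F hn, AbstractCFT.mem_degMultiples_iff, degZ_degHom] at hw
    exact (mem_fieldSubgroup_iff F).mp ((mem_fieldSubgroup_iff_dvd_deg_of_le_maxUnramified hE w).mpr hw) x hx
  · rw [mem_iff_forall_fieldSubgroup_smul E]
    intro w hw
    have hw' : w ∈ fieldSubgroup F (unramifiedLevel F (Module.finrank F E)) := by
      rw [fieldSubgroup_unramifiedLevel F hn, AbstractCFT.mem_degMultiples_iff, degZ_degHom]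
      exact (mem_fieldSubgroup_iff_dvd_deg_of_le_maxUnramified hE w).mp hw
    exact (mem_fieldSubgroup_iff F).mp hw' x hx

/-- **`E = F_n` when `[E:F] = n`** (`E ≤ F^{nr}` finite). [cite: SerreLocalFields1979, Ch. III §5 Thm. 3] -/
theorem eq_unramifiedLevel_of_finrank_eq [CharZero F] {E : IntermediateField F (AlgebraicClosure F)} [FiniteDimensional F E]
    (hE : E ≤ maxUnramified F) {n : ℕ} (hn : Module.finrank F E = n) : E = unramifiedLevel F n := by
  rw [← hn]; exact eq_unramifiedLevel_of_le_maxUnramified hE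

/-! ### Monotonicity in the divisibility order -/

/-- ★ **`n ∣ n' ⇒ F_n ≤ F_{n'}`** (`0 < n'`): an element fixed by all Weil elements of degree `≡ 0 (mod n)` is fixed by those of degree
`≡ 0 (mod n')`. [cite: NeukirchANT1999, Ch. II (7.13)] [cite: SerreLocalFields1979, Ch. IV §4] -/
theorem unramifiedLevel_le_of_dvd [CharZero F] {n n' : ℕ} (hn' : 0 < n') (hdvd : n ∣ n') : unramifiedLevel F n ≤ unramifiedLevel F n' := by
  have hn : 0 < n := Nat.pos_of_dvd_of_pos hdvd hn'
  haveI : FiniteDimensional F (unramifiedLevel F n) := (unramifiedLevel_finite_abelian_unramified F hn).1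
  haveI : FiniteDimensional F (unramifiedLevel F n') := (unramifiedLevel_finite_abelian_unramified F hn').1
  intro x hx
  rw [mem_iff_forall_fieldSubgroup_smul (unramifiedLevel F n')]
  intro w hw
  rw [fieldSubgroup_unramifiedLevel F hn', AbstractCFT.mem_degMultiples_iff, degZ_degHom] at hw
  have hw' : w ∈ fieldSubgroup F (unramifiedLevel F n) := by
    rw [fieldSubgroup_unramifiedLevel F hn, AbstractCFT.mem_degMultiples_iff, degZ_degHom]
    exact (Int.natCast_dvd_natCast.mpr hdvd).trans hw
  exact (mem_fieldSubgroup_iff F).mp hw' x hx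

/-- **A finite `E ≤ F^{nr}` with `[E:F] ∣ n` lies in `F_n`** (`0 < n`). [cite: NeukirchANT1999, Ch. II (7.13)] -/
theorem le_unramifiedLevel_of_finrank_dvd [CharZero F] {E : IntermediateField F (AlgebraicClosure F)} [FiniteDimensional F E]
    (hE : E ≤ maxUnramified F) {n : ℕ} (hn : 0 < n) (hdvd : Module.finrank F E ∣ n) : E ≤ unramifiedLevel F n := by
  rw [eq_unramifiedLevel_of_le_maxUnramified hE]
  exact unramifiedLevel_le_of_dvd hn hdvd

/-! ### The tower `E_k = F_{d·p^k}` -/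

variable (F)

/-- ★ **The chain `k ↦ F_{d·p^k}` is monotone** (`d ≠ 0`, `p ≠ 0`): the hypothesis `hmono` of the Coleman two-variable files.
[cite: deShalit1987, Ch. III §1.3] -/
theorem monotone_unramifiedLevel_mul_pow [CharZero F] (d p : ℕ) [NeZero d] [NeZero p] :
    Monotone fun k => unramifiedLevel F (d * p ^ k) := by
  refine monotone_nat_of_le_succ fun k => unramifiedLevel_le_of_dvd ?_ (mul_dvd_mul_left d (pow_dvd_pow p k.le_succ))
  exact Nat.pos_of_ne_zero (mul_ne_zero (NeZero.ne d) (pow_ne_zero _ (NeZero.ne p)))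

/-- The layers `F_{d·p^k}` are finite over `F`. [cite: SerreLocalFields1979, Ch. IV §4 Cor. to Prop. 16] -/
theorem finiteDimensional_unramifiedLevel_mul_pow (d p : ℕ) [NeZero d] [NeZero p] (k : ℕ) :
    FiniteDimensional F (unramifiedLevel F (d * p ^ k)) :=
  (unramifiedLevel_finite_abelian_unramified F (Nat.pos_of_ne_zero (mul_ne_zero (NeZero.ne d) (pow_ne_zero _ (NeZero.ne p))))).1

/-- The layers `F_{d·p^k}` are Galois over `F`. [cite: SerreLocalFields1979, Ch. IV §4 Cor. to Prop. 16] -/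
theorem isGalois_unramifiedLevel_mul_pow (d p : ℕ) [NeZero d] [NeZero p] (k : ℕ) : IsGalois F (unramifiedLevel F (d * p ^ k)) :=
  isGalois_unramifiedLevel F (Nat.pos_of_ne_zero (mul_ne_zero (NeZero.ne d) (pow_ne_zero _ (NeZero.ne p))))

/-- The layers `F_{d·p^k}` lie in `F^{nr}`: the hypothesis `hE`. [cite: SerreLocalFields1979, Ch. IV §4 Cor. 2 to Prop. 16] -/
theorem unramifiedLevel_mul_pow_le_maxUnramified (d p : ℕ) [NeZero d] [NeZero p] (k : ℕ) :
    unramifiedLevel F (d * p ^ k) ≤ maxUnramified F :=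
  unramifiedLevel_le_maxUnramified F (Nat.pos_of_ne_zero (mul_ne_zero (NeZero.ne d) (pow_ne_zero _ (NeZero.ne p))))

/-- **`[F_{d·p^k} : F] = d·p^k`**: the hypothesis `hdeg`. [cite: SerreLocalFields1979, Ch. III §5 Thm. 3] -/
theorem finrank_unramifiedLevel_mul_pow (d p : ℕ) [NeZero d] [NeZero p] (k : ℕ) :
    Module.finrank F (unramifiedLevel F (d * p ^ k)) = d * p ^ k :=
  finrank_unramifiedLevel F (Nat.pos_of_ne_zero (mul_ne_zero (NeZero.ne d) (pow_ne_zero _ (NeZero.ne p))))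

variable {F}

/-- ★ **Every finite `E ≤ F^{nr}` of degree `d·p^e` is the layer `F_{d·p^e}`** — so the unramified layers of the two-variable tower
(degrees `d·p^{e_m}`) are members of the chain `(F_{d·p^k})_k`, and `LubinTateTowerCofinal` transfers their units.
[cite: SerreLocalFields1979, Ch. III §5 Thm. 3] [cite: deShalit1987, Ch. III §1.3] -/
theorem eq_unramifiedLevel_mul_pow_of_finrank_eq [CharZero F] {E : IntermediateField F (AlgebraicClosure F)} [FiniteDimensional F E]
    (hE : E ≤ maxUnramified F) {d p e : ℕ} (hdeg : Module.finrank F E = d * p ^ e) : E = unramifiedLevel F (d * p ^ e) :=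
  eq_unramifiedLevel_of_finrank_eq hE hdeg

end IsNonarchimedeanLocalField

end Literature.NumberTheory.GaloisRepresentations
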